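import Summits.QuantumFields.GaugeBoot.BootstrapSymmetryConsequences
import Summits.QuantumFields.GaugeBoot.RightShiftRowsUnitary
import HarnessLib

/-!
# Lattice symmetries of the bootstrap IV: the loop equations are covariant under REFLECTIONS (gauge-boot, L1 supplement)

HONEST FRAMING (cell `pub-gaugeboot`, page 1 of every file): the venture produces certified bounds
on lattice expectations at stated coupling, gauge group, dimension and torus size; NOT a mass gap,
NOT a continuum limit, NOT a string tension; NOT Yang–Mills-summit-bearing (barriers
`FixedCouplingUltralocality`, `PerturbativeInvisibility`). Structural; it certifies no number.

## Content

`BootstrapLatticeSymmetry` / `BootstrapAxisPermutations` showed that relabelling a Schwinger–Dyson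
functional by a translation or an axis permutation gives a Schwinger–Dyson functional. The remaining
generator of the lattice symmetry group `B_d ⋉ (ℤ/L)^d`, the site reflection `Θ'` (`negReflectCM`,
`x₀ ↦ -x₀`), is NOT a relabelling: it REVERSES the links along axis `0`, `(Θ'U)_e = U_{θe}⁻¹`, and a
left one-link shift at a reversed link is carried to a RIGHT shift (by the inverse) at its image
(`negReflect_update_reversed`; carried links: `negReflect_update_carried`). With the right rows of
`RightShiftRows(Unitary)`:

* ★★★ `IsSDFunctional.comp_negReflect` — for Wilson local actions of a continuous representation of
  a compact group: a functional satisfying the left AND right loop equations, reflected, satisfies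
  the left loop equations; ★★★ `IsSDFunctional.comp_negReflect_suN` / `_uN` — for `SU(N)` / `U(N)`
  (where right rows follow from left rows) the set of Schwinger–Dyson functionals is invariant under
  `φ ↦ φ ∘ Θ'^*`, at every real `β`, every `d ≥ 1`, `L ≥ 1`;
* ★★★ `isSDFunctional_comp_latticeSymmetry_suN` / `_uN` — summary: the loop equations are covariant
  under every generator of the full lattice symmetry group (translations, axis permutations, the
  reflection), hence — composing — under the whole hyperoctahedral group of the torus; with
  `bootstrap_invariant_suN` (every solution IS symmetric) this is the soundness of writing a lattice
  bootstrap on symmetry classes of loops with loop equations modulo symmetry.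

What this is NOT: a reduction of the test functions at the base link modulo the stabiliser (the
reversal of the base link mixes word lengths through `RightShiftRows`); rates; `L → ∞`.

References: P. Anderson, M. Kruczenski, Nucl. Phys. B 921 (2017) §3; V. Kazakov, Z. Zheng,
arXiv:2203.11360 §3.2; K. Osterwalder, E. Seiler, Ann. Phys. 110 (1978) 440 (the reflection).
Folklore.
-/

noncomputable section

open MeasureTheory Filter Topology NormedSpace
open Literature.MathematicalPhysics.QuantumFieldTheory (LatticeRep Site Edge GaugeConfig wilsonAction
  edgePerm wilsonAction_negReflect_eq)

namespace Summit.QuantumFields.GaugeBoot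

/-! ## The reflection on links and one-link shifts -/

section Geometry

variable {d L : ℕ} [NeZero d] {G : Type*} [Group G]

/-- **The link read by the reflection at `i`**: `θ(y, m) = (θ'y, m)` for a spatial link (`m ≠ 0`),
and the reversed temporal link `(θ'(y + e₀), 0)` for `m = 0`; `(Θ'U)_i = U_{θ i}` resp. `U_{θ i}⁻¹`.
[folklore] -/
def reflEdge (i : Edge d L) : Edge d L :=
  if i.2 = 0 then ((i.1.shift 0).negReflect, 0) else (i.1.negReflect, i.2)

/-- The reflection evaluated through `reflEdge`. -/
theorem negReflect_apply_eq (U : GaugeConfig d L G) (i : Edge d L) :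
    U.negReflect i = if i.2 = 0 then (U (reflEdge i))⁻¹ else U (reflEdge i) := by
  unfold GaugeConfig.negReflect reflEdge
  split_ifs <;> rfl

/-- `reflEdge` is an involution. -/
@[simp] theorem reflEdge_reflEdge (i : Edge d L) : reflEdge (reflEdge i) = i := by
  obtain ⟨y, m⟩ := i
  unfold reflEdge
  by_cases hm : m = 0
  · subst hm
    simp [Literature.MathematicalPhysics.QuantumFieldTheory.WilsonSiteRP.negReflect_shift_negReflect_shift]
  · simp [hm, Literature.MathematicalPhysics.QuantumFieldTheory.WilsonSiteRP.negReflect_negReflect]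

/-- `reflEdge` is injective. -/
theorem reflEdge_injective : Function.Injective (reflEdge (d := d) (L := L)) := fun i j h => by
  rw [← reflEdge_reflEdge i, h, reflEdge_reflEdge]

/-- `reflEdge` preserves the axis. -/
@[simp] theorem reflEdge_snd (i : Edge d L) : (reflEdge i).2 = i.2 := by
  unfold reflEdge
  split_ifs with h
  · exact h.symm
  · rfl

/-- ★ **Carried links**: for a spatial link `i` (`i.2 ≠ 0`) the reflection intertwines the left shift
at `θ i` with the left shift at `i`: `Θ'(U[θi ↦ g U_{θi}]) = (Θ'U)[i ↦ g (Θ'U)_i]`. [folklore] -/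
theorem negReflect_update_carried (U : GaugeConfig d L G) {i : Edge d L} (hi : i.2 ≠ 0) (g : G) :
    GaugeConfig.negReflect (Function.update U (reflEdge i) (g * U (reflEdge i))) =
      Function.update (GaugeConfig.negReflect U) i (g * GaugeConfig.negReflect U i) := by
  funext e
  rw [negReflect_apply_eq, negReflect_apply_eq U i, if_neg hi]
  by_cases he : e = i
  · subst he
    rw [if_neg hi, Function.update_self, Function.update_self]
  · have hne : reflEdge e ≠ reflEdge i := fun h => he (reflEdge_injective h)
    rw [Function.update_of_ne hne, Function.update_of_ne he, negReflect_apply_eq]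

/-- ★ **Reversed links**: for a temporal link `i` (`i.2 = 0`) the reflection turns the RIGHT shift by
`g⁻¹` at `θ i` into the left shift by `g` at `i`: `Θ'(U[θi ↦ U_{θi} g⁻¹]) = (Θ'U)[i ↦ g (Θ'U)_i]`.
[folklore] -/
theorem negReflect_update_reversed (U : GaugeConfig d L G) {i : Edge d L} (hi : i.2 = 0) (g : G) :
    GaugeConfig.negReflect (Function.update U (reflEdge i) (U (reflEdge i) * g⁻¹)) =
      Function.update (GaugeConfig.negReflect U) i (g * GaugeConfig.negReflect U i) := by
  funext e
  rw [negReflect_apply_eq, negReflect_apply_eq U i, if_pos hi]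
  by_cases he : e = i
  · subst he
    rw [if_pos hi, Function.update_self, Function.update_self, mul_inv_rev, inv_inv]
  · have hne : reflEdge e ≠ reflEdge i := fun h => he (reflEdge_injective h)
    rw [Function.update_of_ne hne, Function.update_of_ne he, negReflect_apply_eq]

end Geometry

/-! ## Reflecting a Schwinger–Dyson functional -/

section Reflect

/-- Along a one-parameter group, `k(-t) = k(t)⁻¹`. -/
theorem oneParam_neg {G : Type*} [Group G] {κ : ℝ → G} (hκ : ∀ s t, κ (s + t) = κ s * κ t) (t : ℝ) :
    κ (-t) = (κ t)⁻¹ := by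
  have h0 : κ 0 = 1 := by
    have h := hκ 0 0
    rw [add_zero] at h
    exact mul_eq_left.1 h.symm
  have h := hκ (-t) t
  rw [neg_add_cancel, h0] at h
  exact eq_inv_of_mul_eq_one_left h.symm

/-- Time reversal of a curve negates the derivative at `0`. -/
theorem hasDerivAt_comp_neg_zero {g : ℝ → ℝ} {g' : ℝ} (h : HasDerivAt g g' 0) :
    HasDerivAt (fun t => g (-t)) (-g') 0 := by
  have h0 : HasDerivAt g g' (-0 : ℝ) := by rwa [neg_zero]
  have h2 := h0.scomp (0 : ℝ) (hasDerivAt_neg (0 : ℝ))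
  rw [smul_eq_mul, neg_one_mul] at h2
  exact h2.congr_of_eventuallyEq (Eventually.of_forall fun t => rfl)

variable {d L : ℕ} [NeZero d] [NeZero L] {G : Type*} [Group G] [TopologicalSpace G]
  [IsTopologicalGroup G] [CompactSpace G] (r : LatticeRep G) {N : ℕ} (ρ : G →* Matrix (Fin N) (Fin N) ℂ)
  {K : Type*} {k : K → ℝ → G} {β : ℝ}

/-- ★★★ **Reflecting a Schwinger–Dyson functional gives a Schwinger–Dyson functional** — provided it
also satisfies the RIGHT loop equations (which carry the rows of the reversed links). Wilson local
actions of a continuous representation of a compact group, one-parameter groups `k_a`. [folklore] -/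
theorem IsSDFunctional.comp_negReflect (hρ : Continuous ρ) (hk : ∀ a s t, k a (s + t) = k a s * k a t)
    {φ : C(GaugeConfig d L G, ℝ) →ₗ[ℝ] ℝ}
    (hφ : IsSDFunctional r k (fun _ : Edge d L => wilsonAction ρ) β φ)
    (hφR : IsRightSDFunctional r k (fun _ : Edge d L => wilsonAction ρ) β φ) :
    IsSDFunctional r k (fun _ : Edge d L => wilsonAction ρ) β
      (φ ∘ₗ (ContinuousMap.compRightAlgHom ℝ ℝ (negReflectCM (G := G) (d := d) (L := L))).toLinearMap) := by
  intro i a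
  obtain ⟨S', hS'm, hS', -⟩ := hφ i a
  refine ⟨S', hS'm, hS', fun f hf f' hf'm hf' => ?_⟩
  change φ (f'.comp negReflectCM) = β * φ ((f * S').comp negReflectCM)
  by_cases hi : i.2 = 0
  · -- reversed link: the right row at `θ i`
    obtain ⟨SR, hSRm, hSR, hrowR⟩ := hφR (reflEdge i) a
    have hflip : ∀ (h : GaugeConfig d L G → ℝ) (U : GaugeConfig d L G),
        (fun t => h (GaugeConfig.negReflect (Function.update U (reflEdge i) (U (reflEdge i) * k a t)))) =
          fun t => h (Function.update (GaugeConfig.negReflect U) i (k a (-t) * GaugeConfig.negReflect U i)) := fun h U => by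
      funext t
      rw [← negReflect_update_reversed U hi, ← oneParam_neg (hk a), neg_neg]
    -- right derivative of `f ∘ Θ'` at `θ i` is `-(f' ∘ Θ')`
    have hF' : ∀ U, HasDerivAt (fun t => (f.comp negReflectCM) (Function.update U (reflEdge i) (U (reflEdge i) * k a t)))
        ((-(f'.comp negReflectCM)) U) 0 := fun U => by
      simp only [ContinuousMap.comp_apply, negReflectCM_apply, ContinuousMap.neg_apply]
      rw [hflip]
      exact hasDerivAt_comp_neg_zero (hf' (GaugeConfig.negReflect U))
    -- the right derivative of the action at `θ i` is `-(S' ∘ Θ')`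
    have hSR' : ∀ U, SR U = -S' (GaugeConfig.negReflect U) := fun U => by
      have h1 := hSR U
      have h3 : HasDerivAt (fun t => wilsonAction ρ
          (Function.update U (reflEdge i) (U (reflEdge i) * k a t))) (-S' (GaugeConfig.negReflect U)) 0 := by
        have hfun : (fun t => wilsonAction ρ (Function.update U (reflEdge i) (U (reflEdge i) * k a t))) =
            fun t => wilsonAction ρ (GaugeConfig.negReflect (Function.update U (reflEdge i) (U (reflEdge i) * k a t))) := by
          funext t; rw [wilsonAction_negReflect_eq ρ hρ]
        rw [hfun, hflip]
        exact hasDerivAt_comp_neg_zero (hS' (GaugeConfig.negReflect U))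
      exact h1.unique h3
    have hrow := hrowR (f.comp negReflectCM) (comp_negReflectCM_mem_polyAlgebra r hf) (-(f'.comp negReflectCM))
      (Subalgebra.neg_mem _ (comp_negReflectCM_mem_polyAlgebra r hf'm)) hF'
    have hprod : f.comp negReflectCM * SR = -((f * S').comp (negReflectCM (G := G) (d := d) (L := L))) := by
      ext U
      simp [hSR']
    rw [map_neg, hprod, map_neg] at hrow
    linarith
  · -- carried link: the left row at `θ i`
    obtain ⟨S₂, hS₂m, hS₂, hrow₂⟩ := hφ (reflEdge i) a
    have hflip : ∀ (h : GaugeConfig d L G → ℝ) (U : GaugeConfig d L G),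
        (fun t => h (GaugeConfig.negReflect (Function.update U (reflEdge i) (k a t * U (reflEdge i))))) =
          fun t => h (Function.update (GaugeConfig.negReflect U) i (k a t * GaugeConfig.negReflect U i)) := fun h U => by
      funext t
      rw [negReflect_update_carried U hi]
    have hF' : ∀ U, HasDerivAt (fun t => (f.comp negReflectCM) (Function.update U (reflEdge i) (k a t * U (reflEdge i))))
        ((f'.comp negReflectCM) U) 0 := fun U => by
      simp only [ContinuousMap.comp_apply, negReflectCM_apply]
      rw [hflip]
      exact hf' (GaugeConfig.negReflect U)
    have hS₂' : ∀ U, S₂ U = S' (GaugeConfig.negReflect U) := fun U => by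
      have h3 : HasDerivAt (fun t => wilsonAction ρ
          (Function.update U (reflEdge i) (k a t * U (reflEdge i)))) (S' (GaugeConfig.negReflect U)) 0 := by
        have hfun : (fun t => wilsonAction ρ (Function.update U (reflEdge i) (k a t * U (reflEdge i)))) =
            fun t => wilsonAction ρ (GaugeConfig.negReflect (Function.update U (reflEdge i) (k a t * U (reflEdge i)))) := by
          funext t; rw [wilsonAction_negReflect_eq ρ hρ]
        rw [hfun, hflip]
        exact hS' (GaugeConfig.negReflect U)
      exact (hS₂ U).unique h3
    have hrow := hrow₂ (f.comp negReflectCM) (comp_negReflectCM_mem_polyAlgebra r hf) (f'.comp negReflectCM)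
      (comp_negReflectCM_mem_polyAlgebra r hf'm) hF'
    have hprod : f.comp negReflectCM * S₂ = (f * S').comp (negReflectCM (G := G) (d := d) (L := L)) := by
      ext U
      simp [hS₂']
    rwa [hprod] at hrow

end Reflect

/-! ## `SU(N)` and `U(N)`: covariance under the full lattice symmetry group -/

section Unitary

open Literature.MathematicalPhysics.QuantumLattice

variable {d L : ℕ} [NeZero d] [NeZero L] (N : ℕ) (β : ℝ)

/-- ★★★ **`SU(N)`: reflecting a Schwinger–Dyson functional gives a Schwinger–Dyson functional** (the
right rows follow from the left ones, `isRightSDFunctional_wilson_suN`). Every real `β`, `d ≥ 1`.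
[folklore] -/
theorem IsSDFunctional.comp_negReflect_suN {φ : C(GaugeConfig d L (Matrix.specialUnitaryGroup (Fin N) ℂ), ℝ) →ₗ[ℝ] ℝ}
    (hφ : IsSDFunctional (fundamentalLatticeRep N) (suExp N) (fun _ => wilsonAction (fundamentalRep (Fin N))) β φ) :
    IsSDFunctional (fundamentalLatticeRep N) (suExp N) (fun _ => wilsonAction (fundamentalRep (Fin N))) β
      (φ ∘ₗ (ContinuousMap.compRightAlgHom ℝ ℝ
        (negReflectCM (G := Matrix.specialUnitaryGroup (Fin N) ℂ) (d := d) (L := L))).toLinearMap) :=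
  hφ.comp_negReflect (fundamentalLatticeRep N) (fundamentalRep (Fin N)) (continuous_fundamentalRep _) (suExp_add N)
    (isRightSDFunctional_wilson_suN N β hφ)

/-- ★★★ **`U(N)`: reflecting a Schwinger–Dyson functional gives a Schwinger–Dyson functional.**
[folklore] -/
theorem IsSDFunctional.comp_negReflect_uN {φ : C(GaugeConfig d L (Matrix.unitaryGroup (Fin N) ℂ), ℝ) →ₗ[ℝ] ℝ}
    (hφ : IsSDFunctional (unitaryFundamentalLatticeRep N) (uExp N)
      (fun _ => wilsonAction (unitaryFundamentalRep (Fin N) ℂ)) β φ) :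
    IsSDFunctional (unitaryFundamentalLatticeRep N) (uExp N) (fun _ => wilsonAction (unitaryFundamentalRep (Fin N) ℂ)) β
      (φ ∘ₗ (ContinuousMap.compRightAlgHom ℝ ℝ
        (negReflectCM (G := Matrix.unitaryGroup (Fin N) ℂ) (d := d) (L := L))).toLinearMap) :=
  hφ.comp_negReflect (unitaryFundamentalLatticeRep N) (unitaryFundamentalRep (Fin N) ℂ)
    (continuous_unitaryFundamentalRep _ _) (uExp_add N) (isRightSDFunctional_wilson_uN N β hφ)

/-- ★★★ **Summary (`SU(N)`): the loop equations are covariant under every generator of the lattice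
symmetry group** — translations, axis permutations and the reflection: if `φ` satisfies all loop
equations then so does `f ↦ φ (f ∘ R)`; composing, under the whole group `B_d ⋉ (ℤ/L)^d`. [folklore] -/
theorem isSDFunctional_comp_latticeSymmetry_suN
    {φ : C(GaugeConfig d L (Matrix.specialUnitaryGroup (Fin N) ℂ), ℝ) →ₗ[ℝ] ℝ}
    (hφ : IsSDFunctional (fundamentalLatticeRep N) (suExp N) (fun _ => wilsonAction (fundamentalRep (Fin N))) β φ) :
    ∀ R ∈ (Set.range fun a : Site d L => relabelCM (G := Matrix.specialUnitaryGroup (Fin N) ℂ) (translateEquiv a)) ∪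
        (Set.range fun σ : Equiv.Perm (Fin d) => relabelCM (G := Matrix.specialUnitaryGroup (Fin N) ℂ) (edgePerm (L := L) σ)) ∪
        {negReflectCM},
      IsSDFunctional (fundamentalLatticeRep N) (suExp N) (fun _ => wilsonAction (fundamentalRep (Fin N))) β
        (φ ∘ₗ (ContinuousMap.compRightAlgHom ℝ ℝ R).toLinearMap) := by
  rintro R ((⟨a, rfl⟩ | ⟨σ, rfl⟩) | hR)
  · exact hφ.comp_relabel _ (translateEquiv a) (wilsonAction_relabelCM_translate (fundamentalRep (Fin N)) a)
  · exact hφ.comp_edgePerm (fundamentalRep (Fin N)) (fundamentalLatticeRep N) (continuous_fundamentalRep _) σ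
  · rw [Set.mem_singleton_iff.1 hR]
    exact hφ.comp_negReflect_suN N β

/-- ★★★ **Summary (`U(N)`): the loop equations are covariant under every generator of the lattice
symmetry group.** [folklore] -/
theorem isSDFunctional_comp_latticeSymmetry_uN
    {φ : C(GaugeConfig d L (Matrix.unitaryGroup (Fin N) ℂ), ℝ) →ₗ[ℝ] ℝ}
    (hφ : IsSDFunctional (unitaryFundamentalLatticeRep N) (uExp N)
      (fun _ => wilsonAction (unitaryFundamentalRep (Fin N) ℂ)) β φ) :
    ∀ R ∈ (Set.range fun a : Site d L => relabelCM (G := Matrix.unitaryGroup (Fin N) ℂ) (translateEquiv a)) ∪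
        (Set.range fun σ : Equiv.Perm (Fin d) => relabelCM (G := Matrix.unitaryGroup (Fin N) ℂ) (edgePerm (L := L) σ)) ∪
        {negReflectCM},
      IsSDFunctional (unitaryFundamentalLatticeRep N) (uExp N) (fun _ => wilsonAction (unitaryFundamentalRep (Fin N) ℂ)) β
        (φ ∘ₗ (ContinuousMap.compRightAlgHom ℝ ℝ R).toLinearMap) := by
  rintro R ((⟨a, rfl⟩ | ⟨σ, rfl⟩) | hR)
  · exact hφ.comp_relabel _ (translateEquiv a) (wilsonAction_relabelCM_translate (unitaryFundamentalRep (Fin N) ℂ) a)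
  · exact hφ.comp_edgePerm (unitaryFundamentalRep (Fin N) ℂ) (unitaryFundamentalLatticeRep N)
      (continuous_unitaryFundamentalRep _ _) σ
  · rw [Set.mem_singleton_iff.1 hR]
    exact hφ.comp_negReflect_uN N β

end Unitary

end Summit.QuantumFields.GaugeBoot

end
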